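/-
Copyright (c) 2026. All rights reserved.
Released under Apache 2.0 license as described in the file LICENSE.
-/
import Literature.NumberTheory.PAdicHodge.SenFiniteVectorsBase
import Literature.NumberTheory.PAdicHodge.TateTwistInvariants
import HarnessLib

/-!
# Sen's finite vectors over the base tower: finite-index subgroups and `Γ_F`-orbits

A sequel to `SenFiniteVectorsBase`: the finiteness hypothesis on the orbit of `x ∈ X = \widehat{K_∞}`
there is stated for the FULL group `G₀ = Gal(F̄/K₀)`; for the descent to the `p`-adic field `F`
(Sen's theory is run over `F_∞ = F K_∞` with the group `Γ_F = Gal(F̄/F) ≤ G₀`, of finite index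
`[F : K₀]`) one needs it for the orbit under a subgroup of finite index only.  This file makes
that reduction.

* `TateTrace.exists_mem_image_K_of_orbit_subset_span'` — `SenFiniteVectorsBase`'s theorem with an
  arbitrary finite index type for the spanning family.
* `TateTrace.exists_mem_image_K_of_subgroup_orbit_subset_span` — ★ if `G₀ = T · G'` for a finite
  set `T` and a subgroup `G'`, and the `G'`-orbit of `x ∈ X` lies in the `K₀`-span of finitely many
  elements `b_i` of `ℂ_F`, then the `G₀`-orbit lies in the `K₀`-span of the finitely many `t • b_i`
  (`t ∈ T`), so `x ∈ K_n` for some `n` with `γ_n x = x`.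
* `TateTrace.exists_mem_image_K_of_absoluteGaloisGroup_orbit_subset_span`,
  `TateTrace.mem_S_iff_absoluteGaloisGroup_orbit_subset_span` — ★ the case `G' = Γ_F`: the coset
  representatives are the lifts `s_φ` of the `K₀`-embeddings `φ : F → F̄`
  (`TateDescent.liftEmb`, `TateDescent.mul_liftEmb`, `TateDescent.exists_toBase_eq_corr`), so
  **`(\widehat{K_∞})^{Γ_F-fin} = K_∞`** as well: an element of `\widehat{K_∞}` whose `Γ_F`-orbit
  spans a finite-dimensional `K₀`-space lies in `K_∞`.

References: O. Brinon, B. Conrad, *CMI Summer School notes on p-adic Hodge theory* (2009),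
Thm. 15.1.2 and Thm. 15.1.5 [BrinonConrad2009]; J. Tate, *p-divisible groups* (1967), §3.1
(`Γ_F ≤ G₀`) [Tate1967]; S. Sen, *Continuous cohomology and p-adic Galois representations*,
Invent. Math. 62 (1980) [Sen1980] (original source, not consulted).
-/

noncomputable section

open ValuativeRel Field UniformSpace Finset

namespace Literature.NumberTheory.PAdicHodge

open Literature.NumberTheory.GaloisRepresentations
open Literature.NumberTheory.GaloisRepresentations.IsNonarchimedeanLocalField
open CyclotomicTower

variable {F : Type} [Field F] [ValuativeRel F] [TopologicalSpace F] [IsNonarchimedeanLocalField F]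
  [CharZero F] {p : ℕ} [Fact p.Prime] (hp : valuation F p < 1)

namespace TateTrace

/-- `ι 0 = 0`. [folklore] -/
private theorem ι_zero : ι hp 0 = 0 := by
  rw [← ιHom_apply, map_zero]

/-- `SenFiniteVectorsBase`'s finite-vector theorem with the spanning family indexed by an arbitrary
finite type (reindexing along `Fintype.equivFin`).
[cite: BrinonConrad2009, Thm. 15.1.2 and Thm. 15.1.5 (case of the trivial representation)] -/
theorem exists_mem_image_K_of_orbit_subset_span' {x : CompletedAlgClosure F} (hx : x ∈ X hp)
    {κ : Type} [Fintype κ] (b : κ → CompletedAlgClosure F)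
    (horb : ∀ g : BaseGaloisGroup hp, ∃ c : κ → PadicBase F p hp,
      g • x = ∑ i, ι hp (c i) * b i) :
    ∃ n, 2 ≤ n ∧ gen hp n • x = x ∧
      x ∈ ((↑) : NormedAlgClosure F → CompletedAlgClosure F) '' (K hp n : Set (NormedAlgClosure F)) := by
  classical
  let e := Fintype.equivFin κ
  refine exists_mem_image_K_of_orbit_subset_span hp hx (fun j => b (e.symm j)) fun g => ?_
  obtain ⟨c, hc⟩ := horb g
  refine ⟨fun j => c (e.symm j), hc.trans ?_⟩
  exact (Equiv.sum_comp e.symm (fun i => ι hp (c i) * b i)).symm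

/-- ★ **Finite vectors for a subgroup of finite index.**  Let `G' ≤ G₀` be a subgroup and `T ⊆ G₀`
a finite set with `G₀ = T · G'`.  If `x ∈ X = \widehat{K_∞}` has its `G'`-orbit inside the
`K₀`-span of finitely many `b_i ∈ ℂ_F`, then its `G₀`-orbit lies inside the `K₀`-span of the
finitely many `t • b_i` (`t ∈ T`, `i`) — `(t h) • x = t • ∑ c_i b_i = ∑ c_i (t • b_i)` as `G₀` fixes
`K₀` — and therefore (`exists_mem_image_K_of_orbit_subset_span`) `γ_n x = x` and `x ∈ K_n` for
some `n ≥ 2`.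
[cite: BrinonConrad2009, Thm. 15.1.2 and Thm. 15.1.5 (case of the trivial representation)] -/
theorem exists_mem_image_K_of_subgroup_orbit_subset_span {x : CompletedAlgClosure F} (hx : x ∈ X hp)
    (G' : Subgroup (BaseGaloisGroup hp)) (T : Finset (BaseGaloisGroup hp))
    (hT : ∀ g : BaseGaloisGroup hp, ∃ t ∈ T, ∃ h ∈ G', g = t * h)
    {κ : Type} [Fintype κ] (b : κ → CompletedAlgClosure F)
    (horb : ∀ h ∈ G', ∃ c : κ → PadicBase F p hp, h • x = ∑ i, ι hp (c i) * b i) :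
    ∃ n, 2 ≤ n ∧ gen hp n • x = x ∧
      x ∈ ((↑) : NormedAlgClosure F → CompletedAlgClosure F) '' (K hp n : Set (NormedAlgClosure F)) := by
  classical
  refine exists_mem_image_K_of_orbit_subset_span' hp hx (κ := T × κ)
    (fun ti => ((ti.1 : T) : BaseGaloisGroup hp) • b ti.2) fun g => ?_
  obtain ⟨t, htT, h, hG', rfl⟩ := hT g
  obtain ⟨c, hc⟩ := horb h hG'
  let c' : T × κ → PadicBase F p hp := fun ti => if ti.1 = ⟨t, htT⟩ then c ti.2 else 0
  have key : (t * h) • x = ∑ i, ι hp (c i) * (t • b i) := by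
    rw [mul_smul, hc, Finset.smul_sum]
    simp_rw [smul_mul', base_smul_ι]
  have hsum : ∑ ti : T × κ, ι hp (c' ti) * (((ti.1 : T) : BaseGaloisGroup hp) • b ti.2) =
      ∑ i, ι hp (c i) * (t • b i) := by
    rw [Fintype.sum_prod_type, Finset.sum_eq_single_of_mem (⟨t, htT⟩ : T) (Finset.mem_univ _)]
    · simp [c']
    · intro a _ ha
      simp [c', ha, ι_zero]
  exact ⟨c', key.trans hsum.symm⟩

/-- Every `g ∈ G₀` is `s_φ · toBase σ` for some `K₀`-embedding `φ : F → F̄` and some `σ ∈ Γ_F`: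
`Γ_F` has finite index in `G₀` with coset representatives the lifts `s_φ`
(`TateDescent.mul_liftEmb`, `TateDescent.exists_toBase_eq_corr`; `s_{φ₀} ∈ Γ_F` for the
inclusion `φ₀`). [cite: Tate1967, §3.1] -/
theorem exists_eq_liftEmb_mul_toBase (g : BaseGaloisGroup hp) :
    ∃ φ : TateDescent.Emb hp, ∃ σ : absoluteGaloisGroup F,
      g = TateDescent.liftEmb hp φ * BaseGaloisGroup.toBase hp σ := by
  obtain ⟨σ, hσ⟩ := TateDescent.exists_toBase_eq_corr hp g (TateDescent.emb₀ hp)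
  obtain ⟨σ₀, hσ₀⟩ := BaseGaloisGroup.exists_toBase_eq hp
    (TateDescent.liftEmb hp (TateDescent.emb₀ hp)) (fun c => by
      rw [BaseGaloisGroup.smul_def, TateDescent.liftEmb_algebraMap]
      rfl)
  refine ⟨TateDescent.permEmb hp g (TateDescent.emb₀ hp), σ * σ₀⁻¹, ?_⟩
  have hmul := TateDescent.mul_liftEmb hp g (TateDescent.emb₀ hp)
  rw [map_mul, map_inv, hσ, hσ₀, ← mul_assoc, ← hmul, mul_inv_cancel_right]

/-- ★ **`Γ_F`-finite vectors of `\widehat{K_∞}` lie in `K_∞`.**  If `x ∈ X = \widehat{K_∞}` has its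
`Γ_F = Gal(F̄/F)`-orbit (for the action of `Γ_F` on `ℂ_F`, compatible with that of `G₀` by
`CompletedAlgClosure.toBase_smul_completion`) inside the `K₀`-span of finitely many elements of `ℂ_F`,
then `γ_n x = x` and `x ∈ K_n = K₀(ζ_{p^n})` for some `n ≥ 2` — the finite-index reduction
`exists_mem_image_K_of_subgroup_orbit_subset_span` for `Γ_F ≤ G₀` with the coset representatives
`s_φ` of `exists_eq_liftEmb_mul_toBase`.
[cite: BrinonConrad2009, Thm. 15.1.2 and Thm. 15.1.5 (case of the trivial representation)] -/
theorem exists_mem_image_K_of_absoluteGaloisGroup_orbit_subset_span {x : CompletedAlgClosure F}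
    (hx : x ∈ X hp) {κ : Type} [Fintype κ] (b : κ → CompletedAlgClosure F)
    (horb : ∀ σ : absoluteGaloisGroup F, ∃ c : κ → PadicBase F p hp,
      σ • x = ∑ i, ι hp (c i) * b i) :
    ∃ n, 2 ≤ n ∧ gen hp n • x = x ∧
      x ∈ ((↑) : NormedAlgClosure F → CompletedAlgClosure F) '' (K hp n : Set (NormedAlgClosure F)) := by
  classical
  refine exists_mem_image_K_of_subgroup_orbit_subset_span hp hx (BaseGaloisGroup.toBase hp).range
    (Finset.univ.image (TateDescent.liftEmb hp)) (fun g => ?_) b ?_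
  · obtain ⟨φ, σ, rfl⟩ := exists_eq_liftEmb_mul_toBase hp g
    exact ⟨TateDescent.liftEmb hp φ, Finset.mem_image_of_mem _ (Finset.mem_univ _),
      BaseGaloisGroup.toBase hp σ, ⟨σ, rfl⟩, rfl⟩
  · rintro _ ⟨σ, rfl⟩
    obtain ⟨c, hc⟩ := horb σ
    exact ⟨c, by rw [CompletedAlgClosure.toBase_smul_completion hp]; exact hc⟩

/-- `Γ_F`-finite vectors of `X` lie in `S = K_∞`.
[cite: BrinonConrad2009, Thm. 15.1.2 and Thm. 15.1.5 (case of the trivial representation)] -/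
theorem mem_S_of_absoluteGaloisGroup_orbit_subset_span {x : CompletedAlgClosure F} (hx : x ∈ X hp)
    {κ : Type} [Fintype κ] (b : κ → CompletedAlgClosure F)
    (horb : ∀ σ : absoluteGaloisGroup F, ∃ c : κ → PadicBase F p hp,
      σ • x = ∑ i, ι hp (c i) * b i) :
    x ∈ S hp := by
  obtain ⟨n, -, -, y, hy, rfl⟩ := exists_mem_image_K_of_absoluteGaloisGroup_orbit_subset_span hp hx b horb
  exact coe_mem_S hp (K_le_Kinf hp n hy)

/-- ★ **`(\widehat{K_∞})^{Γ_F-fin} = K_∞`**: an element of `ℂ_F` lies in (the image of) `K_∞` iff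
it lies in `X = \widehat{K_∞}` and its `Γ_F`-orbit lies in the `K₀`-span of finitely many elements
of `ℂ_F`. [cite: BrinonConrad2009, Thm. 15.1.2 and Thm. 15.1.5 (case of the trivial representation)] -/
theorem mem_S_iff_absoluteGaloisGroup_orbit_subset_span (x : CompletedAlgClosure F) :
    x ∈ S hp ↔ x ∈ X hp ∧ ∃ (d : ℕ) (b : Fin d → CompletedAlgClosure F),
      ∀ σ : absoluteGaloisGroup F, ∃ c : Fin d → PadicBase F p hp,
        σ • x = ∑ i, ι hp (c i) * b i := by
  constructor
  · intro hx
    obtain ⟨hX, d, b, horb⟩ := (mem_S_iff_orbit_subset_span hp).mp hx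
    refine ⟨hX, d, b, fun σ => ?_⟩
    obtain ⟨c, hc⟩ := horb (BaseGaloisGroup.toBase hp σ)
    exact ⟨c, by rw [← CompletedAlgClosure.toBase_smul_completion hp]; exact hc⟩
  · rintro ⟨hX, d, b, horb⟩
    exact mem_S_of_absoluteGaloisGroup_orbit_subset_span hp hX b horb

end TateTrace

end Literature.NumberTheory.PAdicHodge
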